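import Mathlib
import Summits.FinalStateConjecture.FinalStateConjecture.Theorems.EternalPapapetrouSchwarzschildExteriorModeRigidityTransport
import HarnessLib

/-!
# Route EternalPapapetrou · SchwarzschildExteriorModeRigidity — vanishing of band-limited jets

Helper file for item stmt-FinalStateConjecture-10039 (`SchwarzschildExteriorModeRigidity`).

A jet `J` of the reduced system over `E = ι → ℝ` which satisfies the inverse-Bernstein
inequality `‖V(t, ρ)‖ ≤ K sup_t ‖V_t(·, ρ)‖`, whose radiation bound `ρ ‖V_t‖ ≤ C_rad` holds and
tends to `0` as `ρ → ∞` uniformly in `t` (two-sided non-radiation), vanishes identically: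
`RWJet.V_eq_zero`. This is `core_eq_zero` applied to the characteristic fields of
`…Transport`. [folklore]
-/

set_option linter.dupNamespace false

noncomputable section

namespace Summit.FinalStateConjecture.FinalStateConjecture.Theorems

open MeasureTheory Set Filter Topology Metric

namespace EternalPapapetrou.ModeRigidity

namespace RWJet

variable {ι : Type*} [Fintype ι] {M : ℝ} {Λ : (ι → ℝ) →L[ℝ] (ι → ℝ)}

/-- The weight `w ρ = 2M/ρ³ + ‖Λ‖/ρ²` is integrable on `(2M, ∞)` for `0 < M`. [folklore] -/
theorem integrableOn_weight (hM : 0 < M) (Λ : (ι → ℝ) →L[ℝ] (ι → ℝ)) :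
    IntegrableOn (fun ρ : ℝ ↦ 2 * M * (ρ⁻¹) ^ 3 + ‖Λ‖ * (ρ⁻¹) ^ 2) (Ioi (2 * M)) := by
  have h2M : 0 < 2 * M := by linarith
  have hpow : ∀ n : ℕ, 2 ≤ n → IntegrableOn (fun ρ : ℝ ↦ (ρ⁻¹) ^ n) (Ioi (2 * M)) := by
    intro n hn
    have h := integrableOn_Ioi_rpow_of_lt (a := -(n : ℝ)) (by
      have : (2 : ℝ) ≤ n := by exact_mod_cast hn
      linarith) h2M
    refine h.congr_fun (fun ρ hρ ↦ ?_) measurableSet_Ioi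
    have hρ : 0 < ρ := lt_trans h2M hρ
    show ρ ^ (-(n : ℝ)) = (ρ⁻¹) ^ n
    rw [Real.rpow_neg hρ.le, Real.rpow_natCast, inv_pow]
  exact ((hpow 3 (by norm_num)).const_mul (2 * M)).add ((hpow 2 le_rfl).const_mul ‖Λ‖)

/-- **Vanishing of band-limited non-radiating jets.** [folklore] -/
theorem V_eq_zero (J : RWJet M Λ) (hM : 0 < M) {K Crad : ℝ} (hK : 0 ≤ K)
    (hBern : ∀ ρ ∈ Ioi (2 * M), ∀ b : ℝ, (∀ t, ‖J.Vt (t, ρ)‖ ≤ b) → ∀ t, ‖J.V (t, ρ)‖ ≤ K * b)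
    (hradB : ∀ t, ∀ ρ ∈ Ioi (2 * M), ρ * ‖J.Vt (t, ρ)‖ ≤ Crad)
    (hrad : ∀ δ > 0, ∃ R, ∀ t ρ, R ≤ ρ → ρ ∈ Ioi (2 * M) → ρ * ‖J.Vt (t, ρ)‖ ≤ δ) :
    ∀ t, ∀ ρ ∈ Ioi (2 * M), J.V (t, ρ) = 0 := by
  have h2M : 0 < 2 * M := by linarith
  -- norms of `G`, `Gt`
  have hG : ∀ t, ∀ ρ ∈ Ioi (2 * M), ‖J.G t ρ‖ = ρ * ‖J.V (t, ρ)‖ := fun t ρ hρ ↦ by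
    rw [G, norm_smul, Real.norm_eq_abs, abs_of_pos (lt_trans h2M hρ)]
  have hGt : ∀ t, ∀ ρ ∈ Ioi (2 * M), ‖J.Gt t ρ‖ = ρ * ‖J.Vt (t, ρ)‖ := fun t ρ hρ ↦ by
    rw [Gt, norm_smul, Real.norm_eq_abs, abs_of_pos (lt_trans h2M hρ)]
  have key := core_eq_zero (2 * M) K (K * Crad) 1 (4 * M) J.G J.P J.Q J.Gt J.F (aF M) (coutF M) id
    (fun ρ ↦ 2 * M * (ρ⁻¹) ^ 3 + ‖Λ‖ * (ρ⁻¹) ^ 2) hK one_pos ?_ continuousOn_coutF continuousOn_id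
    (fun u ρ hρ ↦ J.hasDerivAt_P hM u hρ) (fun u ρ hρ ↦ J.hasDerivAt_G_out u hρ hM)
    (fun u ρ hρ ↦ J.hasDerivAt_Q hM u hρ) (fun u ρ hρ ↦ J.hasDerivAt_G_in u hρ hM)
    (fun t ρ hρ ↦ J.Q_sub_P hM t hρ) ?_ ?_
    (fun ρ hρ ↦ by have : 0 < ρ := lt_trans h2M hρ; positivity) (integrableOn_weight hM Λ)
    ?_ ?_ ?_ ?_
  · intro t ρ hρ
    have h := key t ρ hρ
    rw [G, smul_eq_zero] at h
    exact h.resolve_left (ne_of_gt (lt_trans h2M hρ))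
  · -- continuity of the source
    have hV : ContinuousOn (fun p : ℝ × ℝ ↦ J.V (p.1, p.2)) (strip M) := by
      simpa only [Prod.mk.eta] using J.continuousOn
    have hinv : ContinuousOn (fun p : ℝ × ℝ ↦ p.2⁻¹) (strip M) :=
      continuousOn_snd.inv₀ fun p hp ↦ ne_of_gt (lt_trans h2M hp.2)
    have h1 : ContinuousOn (fun p : ℝ × ℝ ↦ (2 * M * (p.2⁻¹) ^ 2) • J.V (p.1, p.2)) (strip M) :=
      (continuousOn_const.mul (hinv.pow 2)).smul hV
    have h2 : ContinuousOn (fun p : ℝ × ℝ ↦ p.2⁻¹ • Λ (J.V (p.1, p.2))) (strip M) :=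
      hinv.smul (Λ.continuous.comp_continuousOn hV)
    exact h1.sub h2
  · -- `‖F‖ ≤ w ‖G‖`
    intro t ρ hρ
    have hρ0 : 0 < ρ := lt_trans h2M hρ
    have hVn : ‖J.V (t, ρ)‖ = ρ⁻¹ * ‖J.G t ρ‖ := by
      rw [hG t ρ hρ, ← mul_assoc, inv_mul_cancel₀ hρ0.ne', one_mul]
    calc ‖J.F t ρ‖ ≤ ‖(2 * M * (ρ⁻¹) ^ 2) • J.V (t, ρ)‖ + ‖ρ⁻¹ • Λ (J.V (t, ρ))‖ := norm_sub_le _ _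
      _ ≤ 2 * M * (ρ⁻¹) ^ 2 * ‖J.V (t, ρ)‖ + ρ⁻¹ * (‖Λ‖ * ‖J.V (t, ρ)‖) := by
          rw [norm_smul, norm_smul, Real.norm_eq_abs, Real.norm_eq_abs, abs_of_pos (by positivity),
            abs_of_pos (by positivity)]
          gcongr
          exact Λ.le_opNorm _
      _ = (2 * M * (ρ⁻¹) ^ 3 + ‖Λ‖ * (ρ⁻¹) ^ 2) * ‖J.G t ρ‖ := by rw [hVn]; ring
  · -- continuity of the weight
    have hinv : ContinuousOn (fun ρ : ℝ ↦ ρ⁻¹) (Ioi (2 * M)) :=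
      continuousOn_id.inv₀ fun ρ hρ ↦ ne_of_gt (lt_trans h2M hρ)
    exact (continuousOn_const.mul (hinv.pow 3)).add (continuousOn_const.mul (hinv.pow 2))
  · -- the bound on `G`
    intro t ρ hρ
    have hρ0 : 0 < ρ := lt_trans h2M hρ
    have hb : ∀ t', ‖J.Vt (t', ρ)‖ ≤ Crad / ρ := fun t' ↦ by
      rw [le_div_iff₀ hρ0, mul_comm]; exact hradB t' ρ hρ
    have := hBern ρ hρ _ hb t
    rw [hG t ρ hρ]
    calc ρ * ‖J.V (t, ρ)‖ ≤ ρ * (K * (Crad / ρ)) := by gcongr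
      _ = K * Crad := by field_simp
  · -- the lapse factor
    intro ρ hρ
    have hρ0 : 0 < ρ := by linarith
    have h1 : 2 * M * ρ⁻¹ ≤ 1 / 2 := by
      rw [← div_eq_mul_inv, div_le_iff₀ hρ0]; linarith
    have h2 : 0 ≤ 2 * M * ρ⁻¹ := by positivity
    exact ⟨by unfold aF; linarith, by unfold aF; linarith⟩
  · -- non-radiation
    intro ε hε
    obtain ⟨R₀, hR₀⟩ := hrad ε hε
    refine ⟨max R₀ (2 * M + 1), fun t ρ hρ ↦ ?_⟩
    have hρ2 : ρ ∈ Ioi (2 * M) := by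
      show 2 * M < ρ; linarith [le_max_right R₀ (2 * M + 1)]
    rw [hGt t ρ hρ2]
    exact hR₀ t ρ ((le_max_left _ _).trans hρ) hρ2
  · -- the Bernstein step
    intro ρ hρ b hb t
    have hρ0 : 0 < ρ := lt_trans h2M hρ
    have hb' : ∀ t', ‖J.Vt (t', ρ)‖ ≤ b / ρ := fun t' ↦ by
      rw [le_div_iff₀ hρ0, mul_comm, ← hGt t' ρ hρ]; exact hb t'
    have := hBern ρ hρ _ hb' t
    rw [hG t ρ hρ]
    calc ρ * ‖J.V (t, ρ)‖ ≤ ρ * (K * (b / ρ)) := by gcongr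
      _ = K * b := by field_simp

end RWJet

end EternalPapapetrou.ModeRigidity

end Summit.FinalStateConjecture.FinalStateConjecture.Theorems
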